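import Mathlib

/-!
# Slice-sphere tubes: two-sided tubes, half tubes and side germs of an embedded 2-sphere in a 3-slice

Supporting topology for the crux `RootDecompCausalCells.NakedThresholdExit`
(stmt-FinalStateConjecture-24767): the *tube currency* in which one-sided collar conditions on an
embedded sphere `f : S² → X` are typed by the SIGN of a tubular coordinate rather than by global
complement components (decomp-fsc lens-6 generation 22 «TubeCollar», §T1; critic row 212 (c2)).

Main results (pure topology over Mathlib; `X` a charted `C^∞` 3-manifold):
* `IsTube f τ` — `τ : S² × ℝ → X` is a smooth embedding with open image and `τ (p, 0) = f p`;
  `halfTube τ σ = τ '' {σ·t > 0}`, `sideGerm τ σ δ = τ '' {0 < σ·t < δ}`.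
* `IsTube.exists_sideGerm_subset` (tube lemma): every open neighbourhood of the sphere contains both
  side germs of some positive width.
* `IsTube.exists_halfTube_subset_connectedComponentIn` (key lemma): in a connected slice every
  connected component of the complement of a tubed sphere contains one of the two half tubes — so the
  complement has at most two components, whether or not the sphere separates.
-/

open scoped Manifold Topology ContDiff
open Function Set Filter

noncomputable section

-- D-0017: single-problem summit, `Summit.<S>.<S>.…` by design (cf. lakefile `weak.linter.dupNamespace`).
set_option linter.dupNamespace false

namespace Summit.FinalStateConjecture.FinalStateConjecture.Theorems.SliceSphereTubes

/-- Euclidean 3-space, the model of the slice charts. -/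
abbrev E3 := EuclideanSpace ℝ (Fin 3)

variable {X : Type} [TopologicalSpace X] [ChartedSpace E3 X] [IsManifold (𝓡 3) ((⊤ : ℕ∞) : WithTop ℕ∞) X]
  [T2Space X] [SecondCountableTopology X] [ConnectedSpace X]

/-- TWO-SIDED TUBE of a sphere map `f`: `τ : S² × ℝ → X` is a `C^∞` embedding with open image whose zero
section is `f` (a tubular-neighbourhood map; the sign of the `ℝ`-coordinate is the LOCAL side). -/
def IsTube (f : Metric.sphere (0 : E3) 1 → X) (τ : Metric.sphere (0 : E3) 1 × ℝ → X) : Prop :=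
  Manifold.IsSmoothEmbedding ((𝓡 2).prod 𝓘(ℝ, ℝ)) (𝓡 3) ((⊤ : ℕ∞) : WithTop ℕ∞) τ ∧
    IsOpen (Set.range τ) ∧ ∀ p, τ (p, 0) = f p

/-- HALF TUBE on the local side `σ` (`σ = ±1` in every use): the image of `{σ·t > 0}`. -/
def halfTube (τ : Metric.sphere (0 : E3) 1 × ℝ → X) (σ : ℝ) : Set X :=
  τ '' {q | 0 < σ * q.2}

/-- SIDE GERM of width `δ` on the local side `σ`: the image of `{0 < σ·t < δ}`. -/
def sideGerm (τ : Metric.sphere (0 : E3) 1 × ℝ → X) (σ δ : ℝ) : Set X :=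
  τ '' {q | 0 < σ * q.2 ∧ σ * q.2 < δ}

omit [TopologicalSpace X] [ChartedSpace E3 X] [IsManifold (𝓡 3) ((⊤ : ℕ∞) : WithTop ℕ∞) X] [T2Space X]
  [SecondCountableTopology X] [ConnectedSpace X] in
/-- A side germ lies in the half tube of the same sign. -/
theorem sideGerm_subset_halfTube (τ : Metric.sphere (0 : E3) 1 × ℝ → X) (σ δ : ℝ) :
    sideGerm τ σ δ ⊆ halfTube τ σ :=
  Set.image_mono fun _ hq ↦ hq.1

omit [TopologicalSpace X] [ChartedSpace E3 X] [IsManifold (𝓡 3) ((⊤ : ℕ∞) : WithTop ℕ∞) X] [T2Space X]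
  [SecondCountableTopology X] [ConnectedSpace X] in
/-- Side germs of positive width on the sides `σ = ±1` are non-empty. -/
theorem sideGerm_nonempty (τ : Metric.sphere (0 : E3) 1 × ℝ → X) {σ δ : ℝ} (hσ : σ = 1 ∨ σ = -1)
    (hδ : 0 < δ) : (sideGerm τ σ δ).Nonempty := by
  obtain ⟨p, hp⟩ := (NormedSpace.sphere_nonempty (x := (0 : E3)) (r := (1 : ℝ))).mpr zero_le_one
  refine ⟨τ (⟨p, hp⟩, σ * (δ / 2)), (⟨p, hp⟩, σ * (δ / 2)), ?_, rfl⟩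
  have hσ2 : σ * σ = 1 := by rcases hσ with rfl | rfl <;> norm_num
  have hval : σ * (σ * (δ / 2)) = δ / 2 := by rw [← mul_assoc, hσ2, one_mul]
  simp only [mem_setOf_eq, hval]
  constructor <;> linarith

variable {f : Metric.sphere (0 : E3) 1 → X} {τ : Metric.sphere (0 : E3) 1 × ℝ → X}

omit [IsManifold (𝓡 3) ((⊤ : ℕ∞) : WithTop ℕ∞) X] [T2Space X] [SecondCountableTopology X] [ConnectedSpace X] in
/-- A tube map is injective. -/
theorem IsTube.injective (h : IsTube f τ) : Function.Injective τ := h.1.isEmbedding.injective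

omit [IsManifold (𝓡 3) ((⊤ : ℕ∞) : WithTop ℕ∞) X] [T2Space X] [SecondCountableTopology X] [ConnectedSpace X] in
/-- A tube map is continuous. -/
theorem IsTube.continuous (h : IsTube f τ) : Continuous τ := h.1.isEmbedding.continuous

omit [IsManifold (𝓡 3) ((⊤ : ℕ∞) : WithTop ℕ∞) X] [T2Space X] [SecondCountableTopology X] [ConnectedSpace X] in
/-- A tube map is an open topological embedding. -/
theorem IsTube.isOpenEmbedding (h : IsTube f τ) : Topology.IsOpenEmbedding τ := ⟨h.1.isEmbedding, h.2.1⟩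

omit [IsManifold (𝓡 3) ((⊤ : ℕ∞) : WithTop ℕ∞) X] [T2Space X] [SecondCountableTopology X] [ConnectedSpace X] in
/-- The zero section of a tube of `f` is `f`. -/
theorem IsTube.apply_zero (h : IsTube f τ) (p : Metric.sphere (0 : E3) 1) : τ (p, 0) = f p := h.2.2 p

omit [IsManifold (𝓡 3) ((⊤ : ℕ∞) : WithTop ℕ∞) X] [T2Space X] [SecondCountableTopology X] [ConnectedSpace X] in
/-- Points of the tube off its zero section are off the sphere. -/
theorem IsTube.apply_notMem_range (h : IsTube f τ) {p : Metric.sphere (0 : E3) 1} {t : ℝ} (ht : t ≠ 0) :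
    τ (p, t) ∉ Set.range f := by
  rintro ⟨q, hq⟩
  rw [← h.apply_zero q] at hq
  exact ht (Prod.ext_iff.mp (h.injective hq)).2.symm

omit [IsManifold (𝓡 3) ((⊤ : ℕ∞) : WithTop ℕ∞) X] [T2Space X] [SecondCountableTopology X] [ConnectedSpace X] in
/-- Half tubes miss the sphere. -/
theorem IsTube.halfTube_subset_compl_range (h : IsTube f τ) {σ : ℝ} : halfTube τ σ ⊆ (Set.range f)ᶜ := by
  rintro _ ⟨⟨p, t⟩, hq, rfl⟩
  have ht : t ≠ 0 := by
    rintro rfl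
    simp at hq
  exact h.apply_notMem_range ht

omit [IsManifold (𝓡 3) ((⊤ : ℕ∞) : WithTop ℕ∞) X] [T2Space X] [SecondCountableTopology X] [ConnectedSpace X] in
/-- Side germs miss the sphere. -/
theorem IsTube.sideGerm_subset_compl_range (h : IsTube f τ) {σ δ : ℝ} : sideGerm τ σ δ ⊆ (Set.range f)ᶜ :=
  (sideGerm_subset_halfTube τ σ δ).trans h.halfTube_subset_compl_range

omit [IsManifold (𝓡 3) ((⊤ : ℕ∞) : WithTop ℕ∞) X] [T2Space X] [SecondCountableTopology X] [ConnectedSpace X] in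
/-- Half tubes are open. -/
theorem IsTube.isOpen_halfTube (h : IsTube f τ) (σ : ℝ) : IsOpen (halfTube τ σ) := by
  refine h.isOpenEmbedding.isOpenMap _ ?_
  have hc : Continuous fun q : Metric.sphere (0 : E3) 1 × ℝ ↦ σ * q.2 := by fun_prop
  exact isOpen_Ioi.preimage hc

omit [IsManifold (𝓡 3) ((⊤ : ℕ∞) : WithTop ℕ∞) X] [T2Space X] [SecondCountableTopology X] [ConnectedSpace X] in
/-- Side germs are open. -/
theorem IsTube.isOpen_sideGerm (h : IsTube f τ) (σ δ : ℝ) : IsOpen (sideGerm τ σ δ) := by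
  refine h.isOpenEmbedding.isOpenMap _ ?_
  have hc : Continuous fun q : Metric.sphere (0 : E3) 1 × ℝ ↦ σ * q.2 := by fun_prop
  exact isOpen_Ioo.preimage hc

omit [IsManifold (𝓡 3) ((⊤ : ℕ∞) : WithTop ℕ∞) X] [T2Space X] [SecondCountableTopology X] [ConnectedSpace X] in
/-- Each half tube is connected (the 2-sphere is connected). -/
theorem IsTube.isConnected_halfTube (h : IsTube f τ) {σ : ℝ} (hσ : σ = 1 ∨ σ = -1) :
    IsConnected (halfTube τ σ) := by
  haveI : ConnectedSpace (Metric.sphere (0 : E3) 1) :=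
    isConnected_iff_connectedSpace.mp
      (isConnected_sphere (by rw [← Module.finrank_eq_rank]; simp) (0 : E3) zero_le_one)
  have hset : {q : Metric.sphere (0 : E3) 1 × ℝ | 0 < σ * q.2} =
      (Set.univ : Set (Metric.sphere (0 : E3) 1)) ×ˢ {t : ℝ | 0 < σ * t} := by
    ext q
    simp
  have hI : IsConnected {t : ℝ | 0 < σ * t} := by
    rcases hσ with rfl | rfl
    · have : {t : ℝ | 0 < (1 : ℝ) * t} = Set.Ioi 0 := by
        ext t
        simp
      rw [this]
      exact isConnected_Ioi
    · have : {t : ℝ | 0 < (-1 : ℝ) * t} = Set.Iio 0 := by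
        ext t
        simp
      rw [this]
      exact isConnected_Iio
  unfold halfTube
  rw [hset]
  exact (isConnected_univ.prod hI).image τ h.continuous.continuousOn

omit [IsManifold (𝓡 3) ((⊤ : ℕ∞) : WithTop ℕ∞) X] [T2Space X] [SecondCountableTopology X] [ConnectedSpace X] in
/-- TUBE LEMMA: an open neighbourhood of the sphere contains both side germs of some positive width. -/
theorem IsTube.exists_sideGerm_subset (h : IsTube f τ) {N : Set X} (hN : IsOpen N) (hSN : Set.range f ⊆ N) :
    ∃ δ : ℝ, 0 < δ ∧ ∀ σ : ℝ, (σ = 1 ∨ σ = -1) → sideGerm τ σ δ ⊆ N := by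
  have hpre : IsOpen (τ ⁻¹' N) := hN.preimage h.continuous
  have hsub : (Set.univ : Set (Metric.sphere (0 : E3) 1)) ×ˢ ({0} : Set ℝ) ⊆ τ ⁻¹' N := by
    rintro ⟨p, t⟩ ⟨-, ht⟩
    rw [Set.mem_singleton_iff] at ht
    subst ht
    exact hSN ⟨p, (h.apply_zero p).symm⟩
  obtain ⟨u, v, -, hv, hUu, h0v, huv⟩ := generalized_tube_lemma isCompact_univ isCompact_singleton hpre hsub
  have h0 : (0 : ℝ) ∈ v := h0v rfl
  obtain ⟨δ, hδ, hball⟩ := Metric.isOpen_iff.mp hv 0 h0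
  refine ⟨δ, hδ, fun σ hσ ↦ ?_⟩
  rintro _ ⟨⟨p, t⟩, ⟨ht1, ht2⟩, rfl⟩
  have htv : t ∈ v := by
    refine hball ?_
    rw [Metric.mem_ball, Real.dist_0_eq_abs]
    rcases hσ with rfl | rfl
    · rw [abs_of_pos (by linarith)]
      linarith
    · rw [abs_of_neg (by linarith)]
      linarith
  exact huv ⟨hUu (Set.mem_univ p), htv⟩

omit [IsManifold (𝓡 3) ((⊤ : ℕ∞) : WithTop ℕ∞) X] [T2Space X] [SecondCountableTopology X] in
/-- KEY LEMMA: in the connected slice, every connected component of the complement of a tubed sphere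
swallows one of the two half tubes (so the complement has at most two components, and each looks at the
sphere from a definite local side). -/
theorem IsTube.exists_halfTube_subset_connectedComponentIn (h : IsTube f τ) (hSc : IsClosed (Set.range f))
    {x : X} (hx : x ∉ Set.range f) :
    ∃ σ : ℝ, (σ = 1 ∨ σ = -1) ∧ halfTube τ σ ⊆ connectedComponentIn (Set.range f)ᶜ x := by
  haveI : LocallyConnectedSpace X := ChartedSpace.locallyConnectedSpace E3 X
  set C := connectedComponentIn (Set.range f)ᶜ x with hC
  have hCo : IsOpen C := hSc.isOpen_compl.connectedComponentIn
  have hCS : C ⊆ (Set.range f)ᶜ := connectedComponentIn_subset _ _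
  have hxC : x ∈ C := mem_connectedComponentIn hx
  -- a half tube meeting `C` lies inside `C`
  have key : ∀ σ : ℝ, (σ = 1 ∨ σ = -1) → ∀ z ∈ halfTube τ σ, z ∈ C → halfTube τ σ ⊆ C := by
    intro σ hσ z hz hzC
    have h1 : halfTube τ σ ⊆ connectedComponentIn (Set.range f)ᶜ z :=
      (h.isConnected_halfTube hσ).isPreconnected.subset_connectedComponentIn hz h.halfTube_subset_compl_range
    rwa [← connectedComponentIn_eq hzC] at h1
  by_cases hm : ∃ σ : ℝ, (σ = 1 ∨ σ = -1) ∧ ∃ z ∈ halfTube τ σ, z ∈ C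
  · obtain ⟨σ, hσ, z, hz, hzC⟩ := hm
    exact ⟨σ, hσ, key σ hσ z hz hzC⟩
  exfalso
  -- otherwise `C` is closed …
  have hCc : IsClosed C := by
    refine isClosed_of_closure_subset fun y hy ↦ ?_
    by_cases hyS : y ∈ Set.range f
    · exfalso
      obtain ⟨p, rfl⟩ := hyS
      have hmem : Set.range τ ∈ 𝓝 (f p) := h.2.1.mem_nhds ⟨(p, 0), h.apply_zero p⟩
      obtain ⟨_, ⟨⟨p', t⟩, rfl⟩, hzC⟩ := mem_closure_iff_nhds.mp hy _ hmem
      have ht : t ≠ 0 := by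
        rintro rfl
        exact hCS hzC ⟨p', (h.apply_zero p').symm⟩
      rcases lt_or_gt_of_ne ht with hlt | hgt
      · exact hm ⟨-1, Or.inr rfl, τ (p', t), ⟨(p', t), by simpa using hlt, rfl⟩, hzC⟩
      · exact hm ⟨1, Or.inl rfl, τ (p', t), ⟨(p', t), by simpa using hgt, rfl⟩, hzC⟩
    · have hpre : IsPreconnected (insert y C) :=
        isPreconnected_connectedComponentIn.subset_closure (Set.subset_insert _ _)
          (Set.insert_subset hy subset_closure)
      exact hpre.subset_connectedComponentIn (Set.mem_insert_of_mem _ hxC) (Set.insert_subset hyS hCS)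
        (Set.mem_insert _ _)
  -- … hence clopen and non-empty, so all of the connected slice — but it misses the non-empty sphere
  have hCuniv : C = Set.univ := IsClopen.eq_univ ⟨hCc, hCo⟩ ⟨x, hxC⟩
  obtain ⟨p, hp⟩ := (NormedSpace.sphere_nonempty (x := (0 : E3)) (r := (1 : ℝ))).mpr zero_le_one
  have hfp : f ⟨p, hp⟩ ∈ C := by
    rw [hCuniv]
    exact Set.mem_univ _
  exact hCS hfp ⟨⟨p, hp⟩, rfl⟩

end Summit.FinalStateConjecture.FinalStateConjecture.Theorems.SliceSphereTubes

end
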